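import Summits.FinalStateConjecture.FinalStateConjecture.Theses.ClusterCompleteness
import Summits.FinalStateConjecture.FinalStateConjecture.Theorems.StarvedNecksHonestFixedRadiusSettlingStubFlatZoneSojourn
import Summits.FinalStateConjecture.FinalStateConjecture.Theorems.StarvedNecksHonestFixedRadiusSettlingStubEntryBookkeeping

/-!
# Crux `LinearToNonlinearCapture` (stmt-FinalStateConjecture-14526), line `Sketch` — the scri
# split, entering half: the reshape-4 stub S6 from radiation-zone ENTRY (S6a) and the landed
# rate-free flat-zone sojourn lever

Registered sub-goal `scriComplete_of_radiationZoneEntry` of the skeleton `Lines/Sketch.lean`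
(reshape 5, lead prover `prover-line-stmt-FinalStateConjecture-14526-c2-0`, 2026-08-16; proof by
the wave-1 worker on S6). "𝓘⁺ reaches all retarded times" in the sojourn form — for every compact
`Bₑ` a compact `B₀ ⊇ Bₑ` such that, beyond a compact `B₁(s)`, every normalised null ray entering
`J⁺(ι B₀)` is complete or sojourns there `≥ s` — asks only FINITE affine survival after entry,
so no decay RATE is needed: given an ENTRY EVENT into a settled flat chart (the registered stub
`stub_radiationZoneEntry`: a flat-charted point of chart time `≥ τ` inside `J⁺(ι B₀)`, chart
velocity `dΦ w` with `0 < w⁰ ≤ L`, the coordinate cone of height `T` over it inside the flat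
domain), the LANDED lever `StarvedNecks.OneOverDelta.stub_flatZoneSojourn` of the sibling route
(one-sided Grönwall on `log ẋ⁰`: `C¹` deviation `≤ δ` on the slabs `[y⁰, y⁰ + T]` ⇒ survival
`≥ (1 − e^{−CδT})/(CδL)`) with `δ := min δ₀ (1/(2CLs))`, `T := 1/(Cδ)` and lateness `τδ` from
`d.tendsto_deviationCk_flat` gives survival `≥ s`, spent inside `J⁺(ι B₀)` (`J⁺ ∘ J⁺ = J⁺`).
Imports the two StarvedNecks helper modules; otherwise pure bookkeeping (the recurrence
hypothesis and the scalar engine of the crux are inert and dropped here).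
-/

noncomputable section

namespace Summit.FinalStateConjecture.FinalStateConjecture.Theorems

open scoped BigOperators Topology Manifold ENNReal ContDiff
open Filter Set Function TopologicalSpace Bundle MeasureTheory
open Literature.Geometry.Lorentzian
open Summit.FinalStateConjecture.FinalStateConjecture.Theses.ClusterCompleteness
open Summit.FinalStateConjecture.FinalStateConjecture.Theorems.StarvedNecks.OneOverDelta

set_option linter.dupNamespace false in
-- nested operator types `E4 →L[ℝ] E4 →L[ℝ] E4 →L[ℝ] ℝ` (as in the StarvedNecks lever file)
set_option maxSynthPendingDepth 3 in
/-- **Radiation-zone entry plus the rate-free flat-zone sojourn lever close the entering half of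
the scri split.** If far rays of a settling maximal development enter a settled, frame-pinned
radiation zone (`stub_radiationZoneEntry`'s statement, hypothesis `hE`), then for every order
every maximal vacuum Cauchy development of admissible data settling down in the sense of the
Statement has, for every compact `Bₑ`, a compact `B₀ ⊇ Bₑ` such that for every `s > 0`, beyond a compact `B₁`, every
normalised null ray entering `J⁺(ι B₀)` is future complete or sojourns in `J⁺(ι B₀)` for affine
time `≥ s` (the reshape-4 stub `stub_scriComplete_pos` of line `Sketch` is this with the inert engine /
recurrence hypotheses in front and `k := 0`). Proof: `δ := min δ₀ (1/(2CLs))`, `τδ` with flat `C²` deviation `≤ δ` after it,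
`T := 1/(Cδ)`, `B₁ := B₁(τδ, T)`; an entering non-complete ray has an entry event, the velocity
there is null (propagation along the geodesic), the lever keeps `[s₀, s₀ + (1 − e⁻¹)/(CδL)] ⊇
[s₀, s₀ + s]` inside the domain, and from `s₀` on the ray stays in `J⁺(ι B₀)`. -/
theorem scriComplete_of_radiationZoneEntry
    (hE : ∀ (X : Type) [TopologicalSpace X] [ChartedSpace E3 X] [IsManifold (𝓡 3) ∞ X]
          [T2Space X] [SecondCountableTopology X] [ConnectedSpace X],
          ∀ D ∈ admissibleVacuumData X, ∀ 𝒟 : VacuumCauchyDevelopment D, 𝒟.IsMaximal →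
          (∃ (O' : Set 𝒟.carrier) (d : FinalStateDecomposition 𝒟.toSpacetime O' 2),
            (∀ i, Kerr.IsSubextremal (d.mass i) (d.spin i)) ∧
              O' = Summit.FinalStateConjecture.exteriorOf 𝒟.toCauchyDevelopment d.charted ∧
                Summit.FinalStateConjecture.HasExhaustiveCharts d) →
          ∀ [𝒟.metric.HasLeviCivita], ∀ Bₑ : Set X, IsCompact Bₑ →
            ∃ B₀ : Set X, IsCompact B₀ ∧ Bₑ ⊆ B₀ ∧
            ∃ (O'' : Set 𝒟.carrier) (d : FinalStateDecomposition 𝒟.toSpacetime O'' 2) (L : ℝ), 0 < L ∧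
              ∀ τ T : ℝ, ∃ B₁ : Set X, IsCompact B₁ ∧
                ∀ p ∉ B₁, ∀ (γ : ℝ → 𝒟.carrier) (dom : Set ℝ),
                  𝒟.metric.IsNormalisedNullRayFrom 𝒟.timeOrientation 𝒟.embed 𝒟.normal p γ dom →
                  (∃ t ∈ dom, 0 ≤ t ∧
                    γ t ∈ 𝒟.metric.causalFuture 𝒟.timeOrientation (𝒟.embed '' B₀)) →
                  ¬ BddAbove dom ∨
                    ∃ (s₀ : ℝ) (y : d.flatDomain) (w : E4),
                      s₀ ∈ dom ∧ 0 ≤ s₀ ∧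
                      γ s₀ ∈ 𝒟.metric.causalFuture 𝒟.timeOrientation (𝒟.embed '' B₀) ∧
                      γ s₀ = d.flatChart y ∧ d.τ₀ < y.1 0 ∧ τ ≤ y.1 0 ∧
                      velocity (𝓡 4) γ s₀ = mfderiv 𝓘(ℝ, E4) (𝓡 4) d.flatChart y w ∧
                      0 < w 0 ∧ w 0 ≤ L ∧
                      {z : E4 | y.1 0 ≤ z 0 ∧ z 0 ≤ y.1 0 + T ∧
                        ‖E4.spatial z - E4.spatial y.1‖ ≤ 2 * (z 0 - y.1 0) + 1} ⊆
                        (d.flatDomain : Set E4)) :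
    ∀ (X : Type) [TopologicalSpace X] [ChartedSpace E3 X] [IsManifold (𝓡 3) ∞ X]
      [T2Space X] [SecondCountableTopology X] [ConnectedSpace X],
      ∀ D ∈ admissibleVacuumData X, ∀ 𝒟 : VacuumCauchyDevelopment D, 𝒟.IsMaximal →
      (∃ (O' : Set 𝒟.carrier) (d : FinalStateDecomposition 𝒟.toSpacetime O' 2),
        (∀ i, Kerr.IsSubextremal (d.mass i) (d.spin i)) ∧
          O' = Summit.FinalStateConjecture.exteriorOf 𝒟.toCauchyDevelopment d.charted ∧
            Summit.FinalStateConjecture.HasExhaustiveCharts d) →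
      ∀ [𝒟.metric.HasLeviCivita], ∀ Bₑ : Set X, IsCompact Bₑ →
        ∃ B₀ : Set X, IsCompact B₀ ∧ Bₑ ⊆ B₀ ∧ ∀ s : ℝ, 0 < s → ∃ B₁ : Set X, IsCompact B₁ ∧
          ∀ p ∉ B₁, ∀ (γ : ℝ → 𝒟.carrier) (dom : Set ℝ),
            𝒟.metric.IsNormalisedNullRayFrom 𝒟.timeOrientation 𝒟.embed 𝒟.normal p γ dom →
            (∃ t ∈ dom, 0 ≤ t ∧
              γ t ∈ 𝒟.metric.causalFuture 𝒟.timeOrientation (𝒟.embed '' B₀)) →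
            ¬ BddAbove dom ∨ ENNReal.ofReal s ≤
              sojournTime γ dom (𝒟.metric.causalFuture 𝒟.timeOrientation (𝒟.embed '' B₀)) := by
  intro X _ _ _ _ _ _ D hD 𝒟 hmax hsettles _ Bₑ hBₑ
  obtain ⟨B₀, hB₀, hBₑB₀, O', d, L, hL, hfar⟩ := hE X D hD 𝒟 hmax hsettles Bₑ hBₑ
  refine ⟨B₀, hB₀, hBₑB₀, fun s hs ↦ ?_⟩
  obtain ⟨C, hC, δ₀, hδ₀, hZ'⟩ := stub_flatZoneSojourn
  -- the deviation size and the chart time budget (as in `cert_of` of the StarvedNecks line)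
  set δ : ℝ := min δ₀ (1 / (2 * C * L * s)) with hδ_def
  have hδ : 0 < δ := lt_min hδ₀ (by positivity)
  have hδle : δ ≤ δ₀ := min_le_left _ _
  have hδle' : δ ≤ 1 / (2 * C * L * s) := min_le_right _ _
  obtain ⟨τδ, hτδ⟩ : ∃ τδ : ℝ, ∀ τ', τδ ≤ τ' →
      𝒟.toSpacetime.deviationCk (Minkowski.backgroundOn d.flatDomain) d.flatChart 2 τ' ≤
        ENNReal.ofReal δ := by
    have h := (ENNReal.tendsto_nhds_zero.1 d.tendsto_deviationCk_flat) (ENNReal.ofReal δ)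
      (ENNReal.ofReal_pos.2 hδ)
    exact Filter.eventually_atTop.1 h
  set T : ℝ := 1 / (C * δ) with hT_def
  have hT : 0 ≤ T := by positivity
  have hCδT : C * δ * T = 1 := by
    rw [hT_def]
    field_simp
  obtain ⟨B₁, hB₁, hray⟩ := hfar τδ T
  refine ⟨B₁, hB₁, fun p hp γ dom hγ hin ↦ ?_⟩
  rcases hray p hp γ dom hγ hin with hcomplete | ⟨s₀, y, w, hs₀dom, hs₀, hJ, hγy, hlate, hτy,
    hvel, hw0, hwL, hcone⟩
  · exact Or.inl hcomplete
  right
  -- the velocity at the entry event is null (propagated along the null geodesic)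
  have hnull : 𝒟.metric.IsNull (velocity (𝓡 4) γ s₀) := by
    haveI : CovariantDerivative.ContMDiffCovariantDerivative 𝒟.toSpacetime.metric.leviCivita 1 :=
      Spacetime.contMDiffCovariantDerivative_leviCivita_one
    exact (hγ.1.isGeodesicOn.isNull_and_isFutureDirected_velocity 𝒟.toSpacetime.metric
      𝒟.toSpacetime.timeOrientation hγ.1.isOpen hγ.1.2.1 hγ.2.1 hγ.2.2.2.1 hγ.2.2.2.2.1
      hs₀dom).1
  have hdev : ∀ τ' : ℝ, y.1 0 ≤ τ' → τ' ≤ y.1 0 + T →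
      𝒟.toSpacetime.deviationCk (Minkowski.backgroundOn d.flatDomain) d.flatChart 1 τ' ≤
        ENNReal.ofReal δ := by
    intro τ' h1 _
    exact le_trans (𝒟.toSpacetime.deviationCk_mono (Minkowski.backgroundOn d.flatDomain)
      d.flatChart one_le_two τ') (hτδ τ' (hτy.trans h1))
  have hstay := hZ' X D 𝒟 O' 2 d γ dom hγ.isMaximalGeodesicOn s₀ y w L δ T hs₀dom hγy hlate hvel
    hnull hw0 hwL hδ hδle hT hdev hcone
  -- from `s₀` on the ray stays in `J⁺(ι B₀)`
  have hmem : ∀ t ∈ dom, s₀ ≤ t →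
      γ t ∈ 𝒟.metric.causalFuture 𝒟.timeOrientation (𝒟.embed '' B₀) := by
    intro t ht hst
    have h2 := nullRay_apply_mem_causalFuture 𝒟.toSpacetime hγ.1 hγ.2.1 hγ.2.2.2.1
      hγ.2.2.2.2.1 hs₀dom ht hst
    have h3 : γ t ∈ 𝒟.metric.causalFuture 𝒟.timeOrientation
        (𝒟.metric.causalFuture 𝒟.timeOrientation (𝒟.embed '' B₀)) :=
      LorentzianMetric.causalFuture_mono (singleton_subset_iff.2 hJ) h2
    rwa [LorentzianMetric.causalFuture_causalFuture_eq (WithTop.coe_le_coe.mpr le_top)] at h3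
  -- the sojourn bound
  set b : ℝ := (1 - Real.exp (-(C * δ * T))) / (C * δ * L) with hb_def
  have hCδL : 0 < C * δ * L := by positivity
  have hb : s ≤ b := by
    rw [hb_def, le_div_iff₀ hCδL, hCδT]
    have h1 : s * (C * δ * L) ≤ 1 / 2 := by
      calc s * (C * δ * L) = (s * C * L) * δ := by ring
        _ ≤ (s * C * L) * (1 / (2 * C * L * s)) := by gcongr
        _ = 1 / 2 := by field_simp
    have h2 : Real.exp (-1) ≤ 1 / 2 := by
      have h3 : (2 : ℝ) ≤ Real.exp 1 := by
        have := Real.add_one_le_exp (1 : ℝ)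
        linarith
      rw [Real.exp_neg, one_div]
      exact inv_anti₀ (by norm_num) h3
    linarith
  calc ENNReal.ofReal s ≤ ENNReal.ofReal b := ENNReal.ofReal_le_ofReal hb
    _ = volume (Icc s₀ (s₀ + b)) := by rw [Real.volume_Icc, add_sub_cancel_left]
    _ ≤ sojournTime γ dom (𝒟.metric.causalFuture 𝒟.timeOrientation (𝒟.embed '' B₀)) := by
      unfold sojournTime
      exact measure_mono fun t ht ↦
        ⟨hstay t ht.1 ht.2, hs₀.trans ht.1, hmem t (hstay t ht.1 ht.2) ht.1⟩

end Summit.FinalStateConjecture.FinalStateConjecture.Theorems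

end
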